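import Summits.PneNP.PneNP.Theorems.BISOrderDimensionFprasPullback
import Literature.Computability.Complexity.MaxCutNP
import Literature.Computability.Complexity.CodeFPLists
import Literature.Computability.Complexity.CodeFPListKit
import Literature.Computability.Complexity.CanonicalCodes

/-!
# Route BISOrderDimension — `DimThreeToIdeals` (stmt-PneNP-2095)

Restriction glue `DimThreeNoFPRAS → IdealsNoFPRAS`: the dominance transducer `g` maps the code of a 3-row coordinate
instance `⟨n, M⟩` to the code of its dominance matrix `D i j = [∀ k < 3, M k j ≤ M k i]`, so that the down-set count at
dimension 3 of `x` is EXACTLY the ideal count of `g x` (strings that do not decode are mapped to themselves); `g` is a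
typed `CodeFP` program, and an FPRAS for `#IDEALS` pulls back along it (`bisOrderDimension_fpras_pullback`).
-/

set_option linter.dupNamespace false -- `Summit.PneNP.PneNP.…`: summit = sub-problem name (D-0017 single-conjunct layout)

namespace Summit.PneNP.PneNP.Theorems

open _root_.Computability Polynomial
open Literature.Computability.Complexity Literature.Computability.Complexity.CodeFP
  Literature.Computability.Complexity.Brick

/-- The list decoder of `encodingNatBool.listBool` is total, with value `decList`. [folklore] -/
theorem bisOrderDimension_listDecode (c : List Bool) :
    encodingNatBool.listBool.decode c = some (NegCNF.decList decodeNat (boolUnpair c).1.length (boolUnpair c).2) ∧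
      CanonCode.canonListFnC 2 canonF c =
        encodingNatBool.listBool.encode (NegCNF.decList decodeNat (boolUnpair c).1.length (boolUnpair c).2) :=
  CanonCode.canonListFnC_eq encodingNatBool decodeNat (fun _ => rfl) canonF_eq_encodeNat_decodeNat
    (A := 1) (B := 1) (fun u => by have := length_canonF_le u; omega) (by norm_num) c

/-- **The matrix decoder depends only on the header numeral and the decoded entry list.** [folklore] -/
theorem bisOrderDimension_decode_congr (x x' : List Bool) (h1 : decodeNat (fstF x) = decodeNat (fstF x'))
    (h2 : encodingNatBool.listBool.decode (sndF x) = encodingNatBool.listBool.decode (sndF x')) :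
    encodingNatMatrix.decode x = encodingNatMatrix.decode x' := by
  change sigmaBoolDecode encodingNatMatrixFin (decodeNat (fstF x)) (sndF x) =
    sigmaBoolDecode encodingNatMatrixFin (decodeNat (fstF x')) (sndF x')
  rw [h1]
  simp only [sigmaBoolDecode, encodingNatMatrixFin, Encoding.ofEquiv, encodingFinVec]
  change ((encodingListNatBool.decode (sndF x)).bind _ |>.map _ |>.map _) = ((encodingListNatBool.decode (sndF x')).bind _ |>.map _ |>.map _)
  rw [show encodingListNatBool.decode (sndF x) = encodingListNatBool.decode (sndF x') from h2]

/-- **Strings whose entry list has the wrong length do not decode.** [folklore] -/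
theorem bisOrderDimension_decode_none (x : List Bool)
    (h : (NegCNF.decList decodeNat (boolUnpair (sndF x)).1.length (boolUnpair (sndF x)).2).length ≠ decodeNat (fstF x) * decodeNat (fstF x)) :
    encodingNatMatrix.decode x = none := by
  change sigmaBoolDecode encodingNatMatrixFin (decodeNat (fstF x)) (sndF x) = none
  simp only [sigmaBoolDecode, encodingNatMatrixFin, Encoding.ofEquiv, encodingFinVec]
  change ((encodingListNatBool.decode (sndF x)).bind _ |>.map _ |>.map _) = none
  rw [show encodingListNatBool.decode (sndF x) = _ from (bisOrderDimension_listDecode (sndF x)).1]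
  rw [NegCNF.length_decList] at h
  simp [h]

/-- Row-major read-back of an entry list of the right length is the list. [folklore] -/
theorem bisOrderDimension_entriesL_getD {n : ℕ} {l : List ℕ} (hlen : l.length = n * n) :
    MaxCutNP.entriesL n (fun i j : Fin n => l.getD (i * n + j) 0) = l := by
  have e : MaxCutNP.entriesL n (fun i j : Fin n => l.getD (i * n + j) 0) = List.ofFn fun k : Fin (n * n) => l.getD k 0 := by
    refine List.ext_getElem (by simp) fun t h1 h2 => ?_
    have ht : t < n * n := by simpa using h1
    have e1 := MaxCutNP.getD_entriesL (fun i j : Fin n => l.getD (i * n + j) 0) ht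
    rw [List.getD_eq_getElem _ _ h1] at e1
    rw [e1, List.getElem_ofFn]
    change l.getD (t / n * n + t % n) 0 = _
    rw [Nat.div_add_mod' t n]
  rw [e, MaxCutNP.ofFn_getD_nat hlen]

/-- **Strings whose entry list has the right length decode to the matrix read off the list.** [folklore] -/
theorem bisOrderDimension_decode_some (x : List Bool)
    (h : (NegCNF.decList decodeNat (boolUnpair (sndF x)).1.length (boolUnpair (sndF x)).2).length = decodeNat (fstF x) * decodeNat (fstF x)) :
    encodingNatMatrix.decode x = some ⟨decodeNat (fstF x), fun i j : Fin (decodeNat (fstF x)) =>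
      (NegCNF.decList decodeNat (boolUnpair (sndF x)).1.length (boolUnpair (sndF x)).2).getD (i * decodeNat (fstF x) + j) 0⟩ := by
  set n := decodeNat (fstF x) with hn
  set L := NegCNF.decList decodeNat (boolUnpair (sndF x)).1.length (boolUnpair (sndF x)).2 with hL
  set M : Fin n → Fin n → ℕ := fun i j => L.getD (i * n + j) 0 with hM
  have e := bisOrderDimension_decode_congr x (encodingNatMatrix.encode ⟨n, M⟩) (by
      rw [encodingNatMatrix_encode, fstF_boolPair, Computability.decode_encodeNat]) (by
      rw [(bisOrderDimension_listDecode (sndF x)).1, ← hL, encodingNatMatrix_encode, sndF_boolPair,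
        show (encodingNatMatrixFin n).encode M = encodingListNatBool.encode (MaxCutNP.entriesL n M) from rfl,
        encodingListNatBool.decode_encode, bisOrderDimension_entriesL_getD h])
  rw [e, encodingNatMatrix.decode_encode]

/-- **Entry lists as a pass over `[0, n²)`**: if `b i j = w i j` on `Fin n` then `entriesL n w = [b (t / n) (t % n) | t < n²]`.
[folklore] -/
theorem bisOrderDimension_entriesL_eq_map {n : ℕ} (w : Fin n → Fin n → ℕ) (b : ℕ → ℕ → ℕ) (hb : ∀ i j : Fin n, b i j = w i j) :
    MaxCutNP.entriesL n w = (List.range (n * n)).map fun t => b (t / n) (t % n) := by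
  refine List.ext_getElem (by simp) fun t h1 h2 => ?_
  have ht : t < n * n := by simpa using h1
  have e := MaxCutNP.getD_entriesL w ht
  rw [List.getD_eq_getElem _ _ h1] at e
  rw [e, List.getElem_map, List.getElem_range]
  exact (hb ⟨t / n, _⟩ ⟨t % n, _⟩).symm

/-- **The dominance transducer is polynomial time.** On `x` with header `n = ⟦fst x⟧` and decoded entry list `L`
(total decoder): if `|L| = n²` output `⟨bin n, code of [ [∀ k < min(n,3), L[k n + j] ≤ L[k n + i]] | t = i n + j < n² ]⟩`,
else `x`. [cite: AroraBarakCC2009, §1.3] [folklore] -/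
theorem bisOrderDimension_domCode_mem_FP :
    (fun x : List Bool =>
      if decide ((NegCNF.decList decodeNat (boolUnpair (sndF x)).1.length (boolUnpair (sndF x)).2).length =
          decodeNat (fstF x) * decodeNat (fstF x)) then
        boolPair (encodeNat (decodeNat (fstF x))) (listE natE ((List.range (min (decodeNat (fstF x) * decodeNat (fstF x)) x.length)).map
          fun t => if (List.range (min (decodeNat (fstF x)) 3)).all (fun k =>
              decide ((NegCNF.decList decodeNat (boolUnpair (sndF x)).1.length (boolUnpair (sndF x)).2).getD (k * decodeNat (fstF x) + t % decodeNat (fstF x)) 0 ≤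
                (NegCNF.decList decodeNat (boolUnpair (sndF x)).1.length (boolUnpair (sndF x)).2).getD (k * decodeNat (fstF x) + t / decodeNat (fstF x)) 0))
            then 1 else 0))
      else x) ∈ FP := by
  have hfst : CodeFP strE strE fun w : List Bool => fstF w := CodeFP.of_fn fstF fstF_mem_FP fun _ => rfl
  have hsnd : CodeFP strE strE fun w : List Bool => sndF w := CodeFP.of_fn sndF sndF_mem_FP fun _ => rfl
  have hdec : CodeFP strE natE fun w : List Bool => decodeNat w := CodeFP.of_fn canonF canonF_mem_FP canonF_eq_encodeNat_decodeNat
  have hlistC : CodeFP strE (listE natE) fun c : List Bool => NegCNF.decList decodeNat (boolUnpair c).1.length (boolUnpair c).2 :=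
    CodeFP.of_fn (CanonCode.canonListFnC 2 canonF) (CanonCode.canonListFnC_mem_FP 2 canonF_mem_FP) fun c =>
      (bisOrderDimension_listDecode c).2.trans (congrFun (listE_eq encodingNatBool) _)
  have hn : CodeFP strE natE fun x : List Bool => decodeNat (fstF x) := (hdec.comp hfst :)
  have hL : CodeFP strE (rawE natE) fun x : List Bool => NegCNF.decList decodeNat (boolUnpair (sndF x)).1.length (boolUnpair (sndF x)).2 :=
    ((rawOfList natE).comp (hlistC.comp hsnd) :)
  have hlenL := ((natLength natE).comp hL :)
  have hnn : CodeFP strE natE fun x : List Bool => decodeNat (fstF x) * decodeNat (fstF x) := (natMul.comp (hn.pair hn) :)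
  have htest := (natEq.comp (hlenL.pair hnn) :)
  have hidx : CodeFP strE (rawE natE) fun x : List Bool => List.range (min (decodeNat (fstF x) * decodeNat (fstF x)) x.length) :=
    (rangeOf.comp (strLength.pair hnn) :)
  -- one entry, in context `((L, n), t)`; the row index `k` in context `(((L, n), t), k)`
  have qL : CodeFP (pairE (pairE (pairE (rawE natE) natE) natE) natE) (rawE natE) fun q : ((List ℕ × ℕ) × ℕ) × ℕ => q.1.1.1 :=
    (CodeFP.fst _ _).fst'.fst'
  have qn : CodeFP (pairE (pairE (pairE (rawE natE) natE) natE) natE) natE fun q : ((List ℕ × ℕ) × ℕ) × ℕ => q.1.1.2 :=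
    (CodeFP.fst _ _).fst'.snd'
  have qt : CodeFP (pairE (pairE (pairE (rawE natE) natE) natE) natE) natE fun q : ((List ℕ × ℕ) × ℕ) × ℕ => q.1.2 :=
    (CodeFP.fst _ _).snd'
  have qk : CodeFP (pairE (pairE (pairE (rawE natE) natE) natE) natE) natE fun q : ((List ℕ × ℕ) × ℕ) × ℕ => q.2 := CodeFP.snd _ _
  have hget : CodeFP (pairE (rawE natE) natE) natE fun p : List ℕ × ℕ => p.1.getD p.2 0 := rawGetD natE rfl
  have qa : CodeFP (pairE (pairE (pairE (rawE natE) natE) natE) natE) natE fun q : ((List ℕ × ℕ) × ℕ) × ℕ =>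
      q.1.1.1.getD (q.2 * q.1.1.2 + q.1.2 % q.1.1.2) 0 :=
    (hget.comp (qL.pair (natAdd.comp ((natMul.comp (qk.pair qn)).pair (natMod.comp (qt.pair qn))))) :)
  have qb : CodeFP (pairE (pairE (pairE (rawE natE) natE) natE) natE) natE fun q : ((List ℕ × ℕ) × ℕ) × ℕ =>
      q.1.1.1.getD (q.2 * q.1.1.2 + q.1.2 / q.1.1.2) 0 :=
    (hget.comp (qL.pair (natAdd.comp ((natMul.comp (qk.pair qn)).pair (natDiv.comp (qt.pair qn))))) :)
  have hle := (natLe.comp (qa.pair qb) :)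
  have hrows : CodeFP (pairE (pairE (rawE natE) natE) natE) (rawE natE) fun r : (List ℕ × ℕ) × ℕ => List.range (min r.1.2 3) :=
    (rangeOf.comp ((CodeFP.const _ 3).pair (CodeFP.fst _ _).snd') :)
  have hall := ((CodeFP.all hle).comp ((CodeFP.id _).pair hrows) :)
  have helem : CodeFP (pairE (pairE (rawE natE) natE) natE) natE fun r : (List ℕ × ℕ) × ℕ =>
      if (List.range (min r.1.2 3)).all (fun k => decide (r.1.1.getD (k * r.1.2 + r.2 % r.1.2) 0 ≤ r.1.1.getD (k * r.1.2 + r.2 / r.1.2) 0))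
      then 1 else 0 := hall.ite (CodeFP.const _ 1) (CodeFP.const _ 0)
  have hD := ((CodeFP.map (eβ := natE) helem).comp ((hL.pair hn).pair hidx) :)
  have hDl := ((listOfRaw natE).comp hD :)
  obtain ⟨h, hh, hs⟩ := hn.pair hDl
  have hout : CodeFP strE strE fun x : List Bool => boolPair (encodeNat (decodeNat (fstF x)))
      (listE natE ((List.range (min (decodeNat (fstF x) * decodeNat (fstF x)) x.length)).map
        fun t => if (List.range (min (decodeNat (fstF x)) 3)).all (fun k =>
            decide ((NegCNF.decList decodeNat (boolUnpair (sndF x)).1.length (boolUnpair (sndF x)).2).getD (k * decodeNat (fstF x) + t % decodeNat (fstF x)) 0 ≤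
              (NegCNF.decList decodeNat (boolUnpair (sndF x)).1.length (boolUnpair (sndF x)).2).getD (k * decodeNat (fstF x) + t / decodeNat (fstF x)) 0))
          then 1 else 0)) := ⟨h, hh, fun x => hs x⟩
  obtain ⟨G, hG, hGspec⟩ := htest.ite hout (CodeFP.id strE)
  convert hG using 1
  funext x
  exact (hGspec x).symm

/-- **`DimThreeToIdeals` (stmt-PneNP-2095)**: an FPRAS for `#IDEALS` gives one for down-sets of 3-dimensional orders, by
pulling back along the dominance transducer, which preserves the count EXACTLY (the down-sets of the dominance order of
`M` are the ideals of its 0/1 dominance matrix; non-decoding strings are fixed and count `0` on both sides).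
[cite: AroraBarak2009, §7.1] [folklore] -/
theorem bisOrderDimension_dimThreeToIdeals_proof : Summit.PneNP.PneNP.Theses.BISOrderDimension.DimThreeToIdeals := by
  classical
  intro h3 hI
  apply h3
  -- the transducer
  set g : List Bool → List Bool := fun x =>
      if decide ((NegCNF.decList decodeNat (boolUnpair (sndF x)).1.length (boolUnpair (sndF x)).2).length =
          decodeNat (fstF x) * decodeNat (fstF x)) then
        boolPair (encodeNat (decodeNat (fstF x))) (listE natE ((List.range (min (decodeNat (fstF x) * decodeNat (fstF x)) x.length)).map
          fun t => if (List.range (min (decodeNat (fstF x)) 3)).all (fun k =>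
              decide ((NegCNF.decList decodeNat (boolUnpair (sndF x)).1.length (boolUnpair (sndF x)).2).getD (k * decodeNat (fstF x) + t % decodeNat (fstF x)) 0 ≤
                (NegCNF.decList decodeNat (boolUnpair (sndF x)).1.length (boolUnpair (sndF x)).2).getD (k * decodeNat (fstF x) + t / decodeNat (fstF x)) 0))
            then 1 else 0))
      else x with hg
  have hgFP : g ∈ FP := bisOrderDimension_domCode_mem_FP
  refine bisOrderDimension_fpras_pullback (g := g) hgFP (fun x => ?_) hI
  -- `g` preserves the count exactly
  set n := decodeNat (fstF x) with hn
  set L := NegCNF.decList decodeNat (boolUnpair (sndF x)).1.length (boolUnpair (sndF x)).2 with hL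
  by_cases hlen : L.length = n * n
  · -- the dominance matrix
    set M : Fin n → Fin n → ℕ := fun i j => L.getD (i * n + j) 0 with hM
    set D : Fin n → Fin n → ℕ := fun i j => if ∀ k : Fin n, k.val < 3 → M k j ≤ M k i then 1 else 0 with hD
    have hLle : L.length ≤ x.length := by
      rw [hL, NegCNF.length_decList]
      have h1 := length_boolUnpair_parts_le (sndF x)
      have h2 := length_boolUnpair_parts_le x
      have h3 : (sndF x).length = (boolUnpair x).2.length := rfl
      omega
    have hgx : g x = encodingNatMatrix.encode ⟨n, D⟩ := by
      simp only [hg, ← hn, ← hL, decide_eq_true hlen, if_true]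
      rw [encodingNatMatrix_encode, show (encodingNatMatrixFin n).encode D = encodingListNatBool.encode (MaxCutNP.entriesL n D) from rfl,
        congrFun (listE_eq encodingNatBool) _, min_eq_left (a := n * n) (b := x.length) (hlen.symm.le.trans hLle)]
      congr 2
      symm
      refine bisOrderDimension_entriesL_eq_map D
        (fun i j => if (List.range (min n 3)).all (fun k => decide (L.getD (k * n + j) 0 ≤ L.getD (k * n + i) 0)) then 1 else 0)
        fun i j => ?_
      simp only [hD, hM]
      have hiff : ((List.range (min n 3)).all fun k => decide (L.getD (k * n + j) 0 ≤ L.getD (k * n + i) 0)) = true ↔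
          ∀ k : Fin n, k.val < 3 → L.getD (k * n + j) 0 ≤ L.getD (k * n + i) 0 := by
        rw [List.all_eq_true]
        simp only [List.mem_range, lt_min_iff, decide_eq_true_eq]
        exact ⟨fun h k hk => h k ⟨k.isLt, hk⟩, fun h k hk => h ⟨k, hk.1⟩ hk.2⟩
      by_cases hc : ∀ k : Fin n, k.val < 3 → L.getD (k * n + j) 0 ≤ L.getD (k * n + i) 0
      · rw [if_pos (hiff.2 hc), if_pos hc]
      · rw [if_neg (mt hiff.1 hc), if_neg hc]
    rw [hgx, encodingNatMatrix.decode_encode, bisOrderDimension_decode_some x hlen]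
    simp only [Option.elim_some]
    congr 1
    ext I
    simp only [Set.mem_setOf_eq, hD, hM]
    refine forall₂_congr fun i _ => forall_congr' fun j => ?_
    constructor
    · intro h hD0
      by_cases hc : ∀ k : Fin n, k.val < 3 → L.getD (k * n + j) 0 ≤ L.getD (k * n + i) 0
      · exact h hc
      · rw [if_neg hc] at hD0; exact absurd rfl hD0
    · intro h hc
      exact h (by rw [if_pos (show ∀ k : Fin n, k.val < 3 → L.getD (k * n + j) 0 ≤ L.getD (k * n + i) 0 from hc)]; exact one_ne_zero)
  · have hgx : g x = x := by simp only [hg, ← hn, ← hL, hlen, decide_false]; rfl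
    rw [hgx, bisOrderDimension_decode_none x hlen]
    rfl

end Summit.PneNP.PneNP.Theorems
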